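import Summits.QuantumFields.BalabanUV.T4Continuum.Support.ShellMeasurePlaquetteCubicFrozenBox
import Summits.QuantumFields.BalabanUV.T4Continuum.Support.ShellMeasureLandauEndFinalToy
import Summits.QuantumFields.BalabanUV.T4Continuum.Support.ShellMeasureWilsonGradientTailSUN

/-!
# `T4Continuum.ShellMeasureLandauEndBlockSpace` — row S77 f7 (R10, file 1 of 2): THE BLOCK FIELD SPACE OF THE TWO-BOND BLOCK,
# OUR FUNCTIONAL ON IT WITH ITS (P4) BINDER, AND THE (T1) PLUMBING (embedding ∕ read-out ∕ NON-ZERO propagator letter)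
(cell `pub-balaban`, sub-cell `t4`, spine estimate NE7c (node U5b); NE7c ROUND-2 crew, unit
`b2b-balaban-t4-ne7c-formalise-leaf-02` gen 10; journal OFFER l.19686 («S77 f7 R9∕R10»); ADDITIVE — imports R9
`ShellMeasurePlaquetteCubicFrozenBox` (this lineage: the block (P4) binder FIRED in every dimension at symbolic `η`), S88
`ShellMeasureLandauEndFinalToy` (leaf-04-g7: the su(2) letter `toyReadOut` and `norm_toyReadOut_le`, BY NAME) and
`ShellMeasureWilsonGradientTailSUN` (`trCLM`) ONLY; [folklore]; data `def`s only (`C₄c`, the weight∕datum∕space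
abbreviations `wY`∕`wW`∕`DvY`∕`𝕐`∕`𝕎`, `mv₂`, `c₀`, `c₁`, `blockW`, `embL`, `rdL`, `ev1`, `𝒢L`, `εθ₁`; one `instance` — completeness of the
finite-dimensional block space), 0 `def … : Prop`, 0 sorry, 0 citation tags)

HONEST FRAMING.  Finite four-torus programme, rung (B)+1 only — NOT infinite volume, NOT a mass gap, NOT the Clay problem, NOT
summit progress; NE7c (`T4IndicatorShell.ShellWeightBound`) NOT PRINTED, NOT PROVED; «NE7c ⇐ the named binders» (c3).  Linear
bookkeeping for the joint-inhabitation certificate of file 2 (`ShellMeasureLandauEndAssembledBlockP4`); nothing of Bałaban's is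
asserted or discharged.  HONEST DEPENDENCY (cell): continuum YM on T⁴ ⇐ BetaPertH ∧ nine spine estimates (0/9 proved); BetaPertH ⇐
(D1) ∧ (D4) ∧ CAP+tail; G-an2-4 gates asym, D1 and NE2/3/4.

WHY (referee NE7c PASS 22, REFEREE.md «S77 f6 ROAD F» reading (ii) + open items l.33; t4-ref2 C-t4r2-386 caveat (ii)).  R7
`ShellMeasurePlaquetteCubicFrozenBlock.prop4Hyp_pinned_ord₃_eta_levels_frozen_block` typed the (P4) binder of OUR action ON THE
BLOCK FIELD SPACE — «the `𝒴 → 𝒵` shape END-II's `hW` consumes» — but no file applied it AS that `hW` TOGETHER WITH the other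
(T1) slot binders ON THE SAME `𝒴∕𝒵`.  File 2 does; THIS FILE supplies the spaces and the letters living on them:
* §1 the block space **`𝕐 d η := WMax (wY d) 1 (DvY d η)`** over `↥(mv₂ d) → M₂(ℂ)` (`mv₂ d = {(0,0), (0,1)}` TWO moving bonds of
  R9's frozen box `[-1,2]^d`, `d ≥ 2`; `wY ≡ 1·e^{0} = 1`; `DvY d η = covD (boxΛ d) η 1 ∘L extZ incl`; L²-operator norm on `M₂(ℂ)`;
  complete by finite dimension), the target **`𝕎 d := WSup (wW d) 1 (M₂ →L[ℂ] ℂ)`**, OUR block functional **`blockW d η : 𝕐 d η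
  → 𝕎 d`** (R9's data, `τ := tr`) and **`blockW_prop4Hyp`** `: Prop4Hyp (blockW d η) (C₄c d) (1∕8)` for every `d ≥ 1`, `0 < η ≤ 1`
  (R9 `box_frozen_block_fires_le` BY NAME; `tr` tracial by `Matrix.trace_mul_comm`; `C₄c d = ‖tr‖·(72(d−1)(3d+2)d + 427d)`);
* §2 `norm_le_of_letters` (`‖Y‖ ≤ (2∕η)·K` if every letter is `≤ K`: each covariant difference at the flat background reads two
  letters of the extension by zero), the embedding **`embL`** `: (Fin m₀ → ℂ) →L[ℂ] 𝕐 d η` (S88's letter `toyReadOut p e` AT THE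
  FIRST moving bond; **`norm_embL_le`** `≤ (6∕η)‖y‖`), the read-out **`rdL`** (evaluation at the first bond; `norm_rdL_le`,
  `rdL_embL`), and the NON-ZERO **propagator letter `𝒢L d η s : 𝕎 d →L[ℂ] 𝕐 d η`** (read the gradient letter at the first bond,
  write `s·φ(1)·1` at the SECOND: **`rdL_𝒢L`** `rdL (𝒢 g) = 0`, **`norm_𝒢L_le`** `≤ (2∕η)·s·‖g‖`) — so in file 2 B11 Prop. 6's
  fixed point `solAt 𝒢 0 blockW ε₄ 0 𝔄` is a GENUINE solution fed by OUR `blockW`, invisible to the chart read-out;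
  `real_smul_mem_skewAdjoint`; the threshold `εθ₁ S η` of file 2's (SM) equality (`εθ₁_pos`).
NOTHING in the countdown moves; NE7c NOT PROVED; spine PROVED 0∕9.
-/

noncomputable section

open Set Metric NormedSpace Function

namespace Summit.QuantumFields.BalabanUV.T4Continuum.ShellMeasureLandauEndBlockSpace

open scoped Matrix.Norms.L2Operator
open Literature.MathematicalPhysics.QuantumFieldTheory.Balaban1983to89
open B7Eq78Linearization (conjR)
open B8Ineq132 (covDerivFwd norm_conjR_le)
open B11Prop6Scheme (Prop4Hyp)
open TreeLengthTorus (proj)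
open ShellMeasureWilsonGradientTail (plaqWord bonds)
open ShellMeasurePlaquetteTwist (plaqFunSym)
open ShellMeasureLocalGradientTailJet (ord₃)
open ShellMeasureMultiGridNorms (WSup)
open ShellMeasureMultiGridNormsMax (WMax)
open ShellMeasurePinnedNorm (pinW pinDist)
open ShellMeasureWilsonRealizedSU2 (M₂)
open ShellMeasureLandauEndFinalToy (b₁ toyReadOut norm_toyReadOut_le)
open ShellMeasureWilsonGradientTailSUN (trCLM trCLM_apply)
open ShellMeasureCommutatorLocGrad (ext ext_apply_of_mem ext_apply_of_not_mem)
open ShellMeasureCommutatorCovDatum (covIdx covD covD_apply unitW unitW_apply)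
open ShellMeasureLocalGradientTail (locGrad)
open ShellMeasureWilsonRemainderLevels (etaScale)
open ShellMeasurePlaquetteCubicFrozenBlock (extZ extZ_apply_incl extZ_apply_of_forall_ne)
open ShellMeasurePlaquetteCubicFrozenBox (boxΛ boxBd starPl inclOf boxU boxB₀ boxB₀_nonempty subset_boxΛ_of_unit
  unit_of_singleton_zero inclOf_injective box_frozen_block_fires_le)

export B7Prop1Explicit (Site)


/-! ## §1 The block field space of the two-bond block, OUR functional on it, the propagator letter -/

section Block

variable (d : ℕ)

/-- THE (P4) CONSTANT of our block functional: the ORIGINAL stencil constant, cleaned (R9 `box_frozen_block_fires_le`). [folklore] -/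
def C₄c : ℝ := ‖trCLM 2‖ * (72 * ((d : ℝ) - 1) * ((3 * d + 2) * d) + 427 * d)

/-- `0 ≤ C₄c d` for `d ≥ 1`. [folklore] -/
theorem C₄c_nonneg (hd1 : 1 ≤ d) : 0 ≤ C₄c d := by
  have hd : (1 : ℝ) ≤ d := by exact_mod_cast hd1
  unfold C₄c
  have h0 : 0 ≤ (d : ℝ) - 1 := by linarith
  have h1 : 0 ≤ 72 * ((d : ℝ) - 1) * ((3 * d + 2) * d) := by positivity
  have h2 : 0 ≤ 72 * ((d : ℝ) - 1) * ((3 * d + 2) * d) + 427 * d := by positivity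
  exact mul_nonneg (norm_nonneg (trCLM 2)) h2

variable [NeZero d]

/-- THE TWO MOVING BONDS `(0, 0)`, `(0, 1)` (based at the origin, directions `0` and `1`) of the frozen box `[-1,2]^d`:
the chart letter lives on the first, the propagator letter writes on the second. [folklore] -/
def mv₂ : Finset (Site d × Fin d) := {((0 : Site d), (0 : Fin d)), ((0 : Site d), (1 : Fin d))}

/-- `mv₂ d` is based in `[0,1]^d`. [folklore] -/
theorem mv₂_unit : ∀ b ∈ mv₂ d, ∀ i, 0 ≤ b.1 i ∧ b.1 i ≤ 1 := by
  intro b hb i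
  simp only [mv₂, Finset.mem_insert, Finset.mem_singleton] at hb
  rcases hb with rfl | rfl <;> simp

/-- The first moving bond (the chart letter's). [folklore] -/
def c₀ : ↥(mv₂ d) := ⟨((0 : Site d), (0 : Fin d)), by simp [mv₂]⟩

/-- The second moving bond (the propagator letter's). [folklore] -/
def c₁ : ↥(mv₂ d) := ⟨((0 : Site d), (1 : Fin d)), by simp [mv₂]⟩

/-- The two moving bonds are distinct when `d ≥ 2`. [folklore] -/
theorem c₀_ne_c₁ (h01 : (0 : Fin d) ≠ 1) : c₀ d ≠ c₁ d := fun h =>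
  h01 (by simpa [c₀, c₁] using congrArg (fun c : ↥(mv₂ d) => c.1.2) h)

/-- The field weight of the block space: `1·e^{0·ϖ} ≡ 1` (R9's instance of R7's `(wt·pin) ∘ incl`). [folklore] -/
abbrev wY : ↥(mv₂ d) → ℝ := fun c => unitW ↥(boxΛ d) (inclOf (subset_boxΛ_of_unit (mv₂_unit d)) c) *
  pinW 0 (pinDist (boxB₀ d) boxB₀_nonempty ∘ fun c : ↥(mv₂ d) => proj 3 (inclOf (subset_boxΛ_of_unit (mv₂_unit d)) c).1.1) c

/-- The gradient weight of the target space: `1³·e^{0·ϖ} ≡ 1`. [folklore] -/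
abbrev wW : ↥(mv₂ d) → ℝ := fun c => unitW ↥(boxΛ d) (inclOf (subset_boxΛ_of_unit (mv₂_unit d)) c) ^ 3 *
  pinW 0 (pinDist (boxB₀ d) boxB₀_nonempty ∘ fun c : ↥(mv₂ d) => proj 3 (inclOf (subset_boxΛ_of_unit (mv₂_unit d)) c).1.1) c

/-- The ∇-datum of the block space: `covD (boxΛ d) η 1` of the extension by zero (R7∕R9). [folklore] -/
abbrev DvY (η : ℝ) : (↥(mv₂ d) → M₂) →L[ℂ] (↥(covIdx (boxΛ d)) → M₂) :=
  (covD (𝔸 := M₂) (boxΛ d) η (boxU M₂ d)).comp (extZ (inclOf (subset_boxΛ_of_unit (mv₂_unit d))))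

/-- **THE BLOCK FIELD SPACE** `𝕐 d η` — fields on the two moving bonds with values in `M₂(ℂ)`, normed by
`max{|·|_{(−1)}, |∇^η_1 ·|_{(−2)}}` with unit weights (R7's `WMax ((wt·pin) ∘ incl) wd (Dv ∘L extZ)` at R9's data). [folklore] -/
abbrev 𝕐 (η : ℝ) : Type := WMax (wY d) (unitW ↥(covIdx (boxΛ d))) (DvY d η)

/-- **THE TARGET SPACE** `𝕎 d` — gradient letters on the moving bonds, `|·|_{(−3)}` with unit weights. [folklore] -/
abbrev 𝕎 : Type := WSup (wW d) 1 (M₂ →L[ℂ] ℂ)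

/-- The block space is complete (finite-dimensional over `ℂ`). [folklore] -/
instance instCompleteSpace𝕐 (η : ℝ) : CompleteSpace (𝕐 d η) := by
  haveI : FiniteDimensional ℂ (𝕐 d η) := inferInstanceAs (FiniteDimensional ℂ (↥(mv₂ d) → M₂))
  exact FiniteDimensional.complete ℂ _

/-- **OUR BLOCK FUNCTIONAL**: the weighted bond-local gradient of the η-scaled order-≥3 part of the plaquette action of the frozen
box (R9's data: letters `boxΛ d`, plaquettes `starPl (mv₂ d)`, words `boxBd`, `U₀ ≡ 1`, `τ := tr`), read at the moving bonds, as
a map `𝕐 d η → 𝕎 d` (R7's shape). [folklore] -/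
def blockW (η : ℝ) : 𝕐 d η → 𝕎 d := fun Yb =>
  (WSup.toPiL (wW d) 1).symm
    (fun c : ↥(mv₂ d) => locGrad (etaScale η (fun A : ↥(boxΛ d) → M₂ =>
        ∑ p ∈ starPl (mv₂ d), ord₃ (plaqFunSym (trCLM 2) (fun b : ↥(boxΛ d) => boxU M₂ d b.1.1 b.1.2) (boxBd p)) A))
      (WMax.toPiL (fun b => unitW ↥(boxΛ d) b *
          pinW 0 (pinDist (boxB₀ d) boxB₀_nonempty ∘ fun b : ↥(boxΛ d) => proj 3 b.1.1) b)
        (unitW ↥(covIdx (boxΛ d))) (covD (𝔸 := M₂) (boxΛ d) η (boxU M₂ d))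
        ((WMax.toPiL (fun b => unitW ↥(boxΛ d) b *
            pinW 0 (pinDist (boxB₀ d) boxB₀_nonempty ∘ fun b : ↥(boxΛ d) => proj 3 b.1.1) b)
          (unitW ↥(covIdx (boxΛ d))) (covD (𝔸 := M₂) (boxΛ d) η (boxU M₂ d))).symm
          (extZ (inclOf (subset_boxΛ_of_unit (mv₂_unit d))) (WMax.toPiL (wY d) (unitW ↥(covIdx (boxΛ d))) (DvY d η) Yb))))
      (inclOf (subset_boxΛ_of_unit (mv₂_unit d)) c))

/-- **THE (P4) BINDER OF OUR BLOCK FUNCTIONAL** — R9 `box_frozen_block_fires_le` BY NAME (`tr` is tracial): for every `d ≥ 1` and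
`0 < η ≤ 1`, `Prop4Hyp (blockW d η) (C₄c d) (1∕8)`. [folklore] -/
theorem blockW_prop4Hyp (hd1 : 1 ≤ d) {η : ℝ} (hη : 0 < η) (hη1 : η ≤ 1) : Prop4Hyp (blockW d η) (C₄c d) (1 / 8) :=
  box_frozen_block_fires_le (𝔸 := M₂) (trCLM 2) hd1 (mv₂_unit d)
    (fun P Q => by rw [trCLM_apply, trCLM_apply, Matrix.trace_mul_comm]) hη hη1

/-! ## §2 The (T1) plumbing THROUGH the block space: embedding, read-out, propagator letter -/

/-- Letters of the extension by zero of a block field are bounded by the block field's letters. [folklore] -/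
theorem norm_ext_extZ_le (A : ↥(mv₂ d) → M₂) {K : ℝ} (hK : 0 ≤ K) (hA : ∀ c, ‖A c‖ ≤ K) (z : Site d) (τ : Fin d) :
    ‖ext (boxΛ d) (extZ (inclOf (subset_boxΛ_of_unit (mv₂_unit d))) A) z τ‖ ≤ K := by
  by_cases hz : (z, τ) ∈ boxΛ d
  · rw [ext_apply_of_mem (boxΛ d) _ hz]
    by_cases hc : ∃ c : ↥(mv₂ d), inclOf (subset_boxΛ_of_unit (mv₂_unit d)) c = ⟨(z, τ), hz⟩
    · obtain ⟨c, hc⟩ := hc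
      rw [← hc, extZ_apply_incl _ (inclOf_injective _)]
      exact hA c
    · rw [extZ_apply_of_forall_ne _ (fun c h => hc ⟨c, h⟩), norm_zero]
      exact hK
  · rw [ext_apply_of_not_mem (boxΛ d) _ hz, norm_zero]
    exact hK

/-- **THE MAX NORM OF A BLOCK FIELD FROM ITS LETTERS**: if every letter is `≤ K` then `‖Y‖ ≤ (2∕η)·K` (`0 < η ≤ 1`): the
field half is `≤ K`, and each covariant difference at the flat background reads two letters of the extension by zero,
`≤ 2K∕η`. [folklore] -/
theorem norm_le_of_letters {η : ℝ} (hη : 0 < η) (hη1 : η ≤ 1) (Y : 𝕐 d η) {K : ℝ} (hK : 0 ≤ K)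
    (hA : ∀ c, ‖(show ↥(mv₂ d) → M₂ from Y) c‖ ≤ K) : ‖Y‖ ≤ 2 / η * K := by
  have h2 : K ≤ 2 / η * K := by
    have : (1 : ℝ) ≤ 2 / η := by rw [le_div_iff₀ hη]; linarith
    nlinarith
  have h0 : 0 ≤ 2 / η * K := hK.trans h2
  rw [WMax.norm_def]
  refine max_le ?_ ?_
  · refine (WSup.norm_le_iff (wY d) 1 h0).2 fun c => ?_
    have hw : wY d c = 1 := by simp [wY, unitW_apply]
    rw [hw, one_pow, one_mul]
    exact (hA c).trans h2
  · refine (WSup.norm_le_iff (unitW ↥(covIdx (boxΛ d))) 2 h0).2 fun i => ?_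
    rw [unitW_apply, one_pow, one_mul]
    show ‖(DvY d η) (WMax.toPiL (wY d) (unitW ↥(covIdx (boxΛ d))) (DvY d η) Y) i‖ ≤ _
    rw [ContinuousLinearMap.comp_apply, covD_apply, covDerivFwd, norm_smul, norm_inv, Real.norm_of_nonneg hη.le]
    have h1 := norm_ext_extZ_le d (WMax.toPiL (wY d) (unitW ↥(covIdx (boxΛ d))) (DvY d η) Y) hK hA
      (i.1.1 + B7Prop1Explicit.e i.1.2.1) i.1.2.2
    have h2' := norm_ext_extZ_le d (WMax.toPiL (wY d) (unitW ↥(covIdx (boxΛ d))) (DvY d η) Y) hK hA i.1.1 i.1.2.2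
    have hc := norm_conjR_le (ShellMeasurePlaquetteCubicFrozenBox.box_h₀ (𝔸 := M₂) i.1.1 i.1.2.1)
      (ext (boxΛ d) (extZ (inclOf (subset_boxΛ_of_unit (mv₂_unit d)))
        (WMax.toPiL (wY d) (unitW ↥(covIdx (boxΛ d))) (DvY d η) Y)) (i.1.1 + B7Prop1Explicit.e i.1.2.1) i.1.2.2)
    calc η⁻¹ * ‖conjR (boxU M₂ d i.1.1 i.1.2.1) (ext (boxΛ d) (extZ (inclOf (subset_boxΛ_of_unit (mv₂_unit d)))
            (WMax.toPiL (wY d) (unitW ↥(covIdx (boxΛ d))) (DvY d η) Y)) (i.1.1 + B7Prop1Explicit.e i.1.2.1) i.1.2.2) -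
          ext (boxΛ d) (extZ (inclOf (subset_boxΛ_of_unit (mv₂_unit d)))
            (WMax.toPiL (wY d) (unitW ↥(covIdx (boxΛ d))) (DvY d η) Y)) i.1.1 i.1.2.2‖
        ≤ η⁻¹ * (K + K) := by
          refine mul_le_mul_of_nonneg_left ((norm_sub_le _ _).trans (add_le_add (hc.trans h1) h2')) (inv_nonneg.2 hη.le)
      _ = 2 / η * K := by rw [div_eq_mul_inv]; ring

variable {P : Params} {j : ℕ}

/-- THE EMBEDDING of the chart coordinates into the block space: S88's su(2) letter placed at the FIRST moving bond (zero at the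
second). [folklore] -/
def embL (p : Plaq P j) {m₀ : ℕ} (e : ↥({b₁ p} : Finset (PBond P j)) × Fin 3 ≃ Fin m₀) (η : ℝ) :
    (Fin m₀ → ℂ) →L[ℂ] 𝕐 d η :=
  ((WMax.toPiL (wY d) (unitW ↥(covIdx (boxΛ d))) (DvY d η)).symm : (↥(mv₂ d) → M₂) →L[ℂ] 𝕐 d η).comp
    ((ContinuousLinearMap.single ℂ (fun _ : ↥(mv₂ d) => M₂) (c₀ d)).comp (toyReadOut p e))

/-- Unfolding: the embedded field is `Pi.single c₀ (toyReadOut y)`. [folklore] -/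
theorem embL_apply (p : Plaq P j) {m₀ : ℕ} (e : ↥({b₁ p} : Finset (PBond P j)) × Fin 3 ≃ Fin m₀) (η : ℝ)
    (y : Fin m₀ → ℂ) : (show ↥(mv₂ d) → M₂ from embL d p e η y) = Pi.single (c₀ d) (toyReadOut p e y) := rfl

/-- THE READ-OUT: evaluation at the first moving bond. [folklore] -/
def rdL (η : ℝ) : 𝕐 d η →L[ℂ] M₂ :=
  (ContinuousLinearMap.proj (R := ℂ) (φ := fun _ : ↥(mv₂ d) => M₂) (c₀ d)).comp
    (WMax.toPiL (wY d) (unitW ↥(covIdx (boxΛ d))) (DvY d η) : 𝕐 d η →L[ℂ] (↥(mv₂ d) → M₂))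

/-- READING A GRADIENT LETTER AS A FIELD LETTER: `φ ↦ φ(1)·1`. [folklore] -/
def ev1 : (M₂ →L[ℂ] ℂ) →L[ℂ] M₂ := (ContinuousLinearMap.apply ℂ ℂ (1 : M₂)).smulRight (1 : M₂)

/-- Unfolding. [folklore] -/
theorem ev1_apply (φ : M₂ →L[ℂ] ℂ) : ev1 φ = φ 1 • (1 : M₂) := rfl

/-- `‖ev1 φ‖ ≤ ‖φ‖` (`‖1‖ = 1` in the operator norm). [folklore] -/
theorem norm_ev1_le (φ : M₂ →L[ℂ] ℂ) : ‖ev1 φ‖ ≤ ‖φ‖ := by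
  rw [ev1_apply, norm_smul, norm_one, mul_one]
  simpa using φ.le_opNorm (1 : M₂)

/-- **THE PROPAGATOR LETTER** `𝒢 : 𝕎 d → 𝕐 d η` (NON-ZERO): read the gradient letter at the FIRST moving bond, write `s·φ(1)·1`
at the SECOND — so the chart read-out at the first bond never sees it, while B11 Prop. 6's fixed point is fed by OUR `blockW`.
[folklore] -/
def 𝒢L (η s : ℝ) : 𝕎 d →L[ℂ] 𝕐 d η :=
  ((WMax.toPiL (wY d) (unitW ↥(covIdx (boxΛ d))) (DvY d η)).symm : (↥(mv₂ d) → M₂) →L[ℂ] 𝕐 d η).comp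
    ((ContinuousLinearMap.single ℂ (fun _ : ↥(mv₂ d) => M₂) (c₁ d)).comp
      ((s : ℂ) • (ev1.comp ((ContinuousLinearMap.proj (R := ℂ) (φ := fun _ : ↥(mv₂ d) => (M₂ →L[ℂ] ℂ)) (c₀ d)).comp
        (WSup.toPiL (𝔄 := (M₂ →L[ℂ] ℂ)) (wW d) 1 : 𝕎 d →L[ℂ] (↥(mv₂ d) → (M₂ →L[ℂ] ℂ)))))))

/-- Unfolding: `𝒢 g = Pi.single c₁ (s·(g c₀)(1)·1)`. [folklore] -/
theorem 𝒢L_apply (η s : ℝ) (g : 𝕎 d) : (show ↥(mv₂ d) → M₂ from 𝒢L d η s g) =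
    Pi.single (c₁ d) ((s : ℂ) • ev1 ((show ↥(mv₂ d) → (M₂ →L[ℂ] ℂ) from g) (c₀ d))) := rfl

/-- The read-out of the embedded field is S88's letter. [folklore] -/
theorem rdL_embL (p : Plaq P j) {m₀ : ℕ} (e : ↥({b₁ p} : Finset (PBond P j)) × Fin 3 ≃ Fin m₀) (η : ℝ)
    (y : Fin m₀ → ℂ) : rdL d η (embL d p e η y) = toyReadOut p e y := by
  show (show ↥(mv₂ d) → M₂ from embL d p e η y) (c₀ d) = _
  rw [embL_apply, Pi.single_eq_same]

/-- The letters of the embedded field are bounded by S88's letter. [folklore] -/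
theorem norm_embL_letter_le (p : Plaq P j) {m₀ : ℕ} (e : ↥({b₁ p} : Finset (PBond P j)) × Fin 3 ≃ Fin m₀) (η : ℝ)
    (y : Fin m₀ → ℂ) (c : ↥(mv₂ d)) : ‖(show ↥(mv₂ d) → M₂ from embL d p e η y) c‖ ≤ ‖toyReadOut p e y‖ := by
  rw [embL_apply]
  rcases eq_or_ne c (c₀ d) with rfl | h
  · rw [Pi.single_eq_same]
  · rw [Pi.single_eq_of_ne h, norm_zero]; exact norm_nonneg _

/-- **THE READ-OUT NEVER SEES THE PROPAGATOR LETTER**: `rdL (𝒢 g) = 0` (`d ≥ 2`). [folklore] -/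
theorem rdL_𝒢L (h01 : (0 : Fin d) ≠ 1) (η s : ℝ) (g : 𝕎 d) : rdL d η (𝒢L d η s g) = 0 := by
  show (show ↥(mv₂ d) → M₂ from 𝒢L d η s g) (c₀ d) = 0
  rw [𝒢L_apply, Pi.single_eq_of_ne (c₀_ne_c₁ d h01)]

/-- The letters of `𝒢 g` are bounded by `s·‖g‖` (`0 ≤ s`). [folklore] -/
theorem norm_𝒢L_letter_le {η s : ℝ} (hs : 0 ≤ s) (g : 𝕎 d) (c : ↥(mv₂ d)) :
    ‖(show ↥(mv₂ d) → M₂ from 𝒢L d η s g) c‖ ≤ s * ‖g‖ := by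
  have hg : ‖(show ↥(mv₂ d) → (M₂ →L[ℂ] ℂ) from g) (c₀ d)‖ ≤ ‖g‖ := by
    have h := WSup.norm_apply_le (wW d) 1 g (c₀ d)
    have hw : wW d (c₀ d) = 1 := by simp [wW, unitW_apply]
    rwa [hw, one_pow, one_mul] at h
  rw [𝒢L_apply]
  rcases eq_or_ne c (c₁ d) with rfl | h
  · rw [Pi.single_eq_same, norm_smul, Complex.norm_real, Real.norm_of_nonneg hs]
    exact mul_le_mul_of_nonneg_left ((norm_ev1_le _).trans hg) hs
  · rw [Pi.single_eq_of_ne h, norm_zero]; positivity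

/-- `‖rdL Y‖ ≤ ‖Y‖` (a unit-weight component is below the weighted sup, which is below the max norm). [folklore] -/
theorem norm_rdL_le (η : ℝ) (Y : 𝕐 d η) : ‖rdL d η Y‖ ≤ ‖Y‖ := by
  have h := WSup.norm_apply_le (wY d) 1 (show WSup (wY d) 1 M₂ from Y) (c₀ d)
  have hw : wY d (c₀ d) = 1 := by simp [wY, unitW_apply]
  rw [hw, one_pow, one_mul] at h
  exact h.trans (WMax.norm_wsup_le (wY d) (unitW ↥(covIdx (boxΛ d))) (DvY d η) Y)

/-- **THE EMBEDDING IS BOUNDED BY `6∕η`.** [folklore] -/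
theorem norm_embL_le (p : Plaq P j) {m₀ : ℕ} (e : ↥({b₁ p} : Finset (PBond P j)) × Fin 3 ≃ Fin m₀) {η : ℝ} (hη : 0 < η)
    (hη1 : η ≤ 1) (y : Fin m₀ → ℂ) : ‖embL d p e η y‖ ≤ 6 / η * ‖y‖ := by
  have h := norm_le_of_letters d hη hη1 (embL d p e η y) (K := 3 * ‖y‖) (by positivity)
    (fun c => (norm_embL_letter_le d p e η y c).trans (norm_toyReadOut_le p e y))
  calc ‖embL d p e η y‖ ≤ 2 / η * (3 * ‖y‖) := h
    _ = 6 / η * ‖y‖ := by ring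

/-- **THE PROPAGATOR LETTER IS BOUNDED BY `(2∕η)·s`.** [folklore] -/
theorem norm_𝒢L_le {η s : ℝ} (hη : 0 < η) (hη1 : η ≤ 1) (hs : 0 ≤ s) (g : 𝕎 d) :
    ‖𝒢L d η s g‖ ≤ 2 / η * (s * ‖g‖) :=
  norm_le_of_letters d hη hη1 (𝒢L d η s g) (by positivity) (norm_𝒢L_letter_le d hs g)

/-- real scalar multiples of skew-adjoint matrices are skew-adjoint. [folklore] -/
theorem real_smul_mem_skewAdjoint {A : M₂} (hA : A ∈ skewAdjoint M₂) (r : ℝ) : ((r : ℂ) • A) ∈ skewAdjoint M₂ := by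
  rw [skewAdjoint.mem_iff] at hA ⊢
  rw [star_smul, Complex.star_def, Complex.conj_ofReal, hA, smul_neg]

/-- THE THRESHOLD making (SM) an equality for the block-space read-out data (`c₁ = 1∕(16η²)`, `c₂ = 1∕(16η)`, `z = 1`, `m = 1`,
`r_Φ = η∕192`, `δ = ½`). [folklore] -/
def εθ₁ (S η : ℝ) : ℝ := 72 * (1 / (16 * η ^ 2) * 1 + (1 : ℕ) ^ 2 * (1 / (16 * η)) ^ 2 * 1 ^ 2) / ((η / 192) / S - 1) ^ 2

omit [NeZero d] in
/-- `0 < εθ₁ S η` in the window regime `0 < S < η∕192`. [folklore] -/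
theorem εθ₁_pos {S η : ℝ} (hS : 0 < S) (hη : 0 < η) (hSη : S < η / 192) : 0 < εθ₁ S η := by
  unfold εθ₁
  have h1 : 1 < (η / 192) / S := by rw [lt_div_iff₀ hS]; linarith
  have h2 : 0 < ((η / 192) / S - 1) ^ 2 := by nlinarith
  have h3 : 0 < 1 / (16 * η ^ 2) * 1 + ((1 : ℕ) : ℝ) ^ 2 * (1 / (16 * η)) ^ 2 * 1 ^ 2 := by positivity
  positivity

end Block

end Summit.QuantumFields.BalabanUV.T4Continuum.ShellMeasureLandauEndBlockSpace

end
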